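import Summits.QuantumAdvantage.AdviceFreeQNC0.AffBells29Toggle
import HarnessLib

/-!
# Sketch29 v3, part 5/5 (planner qn-p1 g29, ROUND-28): §29.7 **`hClassB : HClassB` PROVED** (the weighted re-indexing `mass_eq_univ`, `mass_classIsoFM_le`), **`polyLoss_of_classA : HClassA → AffBellsPolyLoss3`**, `hCube_of_classA` — (NP₁) hangs on the single c-free conjecture `HClassA`

(VERBATIM slice of `HOME/qa-qnc0-p1/exp29/Sketch29.lean` (sha16 `d7934601fa3f468f`, 1191 l., farm rc 0 / 0 sorry / 0 warnings), authored AND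
proved by the planner seat qn-p1 g29; landed by the prover seat qn-prover-3 g14 (ask P-29b) as five files (400-line rule).  Changes: file
boundaries with per-file preamble, one-line docstrings on undocumented auxiliaries (lint), and in part 1 the planner's re-proofs
`AffBells29.peeling/peelingList` are omitted in favour of the landed `AffBells28.peeling/peelingList` (gate dedup), as the ask allows.)
WHAT THIS IS NOT: `HClassA` (the one remaining c-free conjecture of the (NP₁) plan) is NOT touched; separation NOT moved.
-/

namespace Summit.QuantumAdvantage.AdviceFreeQNC0

namespace AffBells29

open Finset Literature.Computability.QuantumComplexity Literature.Computability.QuantumComplexity.RingHLF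
open AffBells23 AffBells26 Fib19 AffBells27 AffBells28

variable {N : ℕ}

/-! ### §29.7 `HClassB` PROVED — the weighted re-indexing

With `cube_or_toggle` the parity layer is a double count: write both masses as sums over ALL `(x, C₀)` with indicators (`mass_eq_univ`); at a
`ClassIsoFM` window either the cube term at the same index is the full weight, or the cube term at `(x ⊕ P_u, C₀)` is `≥ ω/(Z+1)` (`StableLaw`);
summing over the free member `u ∈ Fin N` as an extra index and re-indexing `x ↦ x ⊕ P_u` (an involution of the cube) gives
`mass ClassIsoFM ≤ (1 + N(Z+1))·mass CubeWitness ≤ N^{K+2}·mass CubeWitness`.  Hence **`hClassB : HClassB`** and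
**`polyLoss_of_classA : HClassA → AffBellsPolyLoss3`**: (NP₁) now hangs on the ONE c-free structural conjecture `HClassA`. -/

/-- Auxiliary step `flipAt_single_eq_update` of Sketch29 (planner qa-qnc0-p1 g29, v3, verbatim). -/
theorem flipAt_single_eq_update {J : Fin N → Bool} {u : Fin N} (hu : J u = true) : flipAt J {u} = Function.update J u false := by
  funext i
  unfold flipAt
  by_cases h : i = u
  · subst h
    simp [hu]
  · simp [h]

/-- Auxiliary step `flipAt_involutive` of Sketch29 (planner qa-qnc0-p1 g29, v3, verbatim). -/
theorem flipAt_involutive (P : Finset (Fin N)) : Function.Involutive (fun x : Fin N → Bool => flipAt x P) :=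
  fun x => flipAt_flipAt x P

open scoped Classical in
/-- The summand of the `univ`-indexed form of `mass`. -/
noncomputable def term (W : ∀ {N : ℕ}, (Fin N → Fin N → ZMod 3) → (Fin N → ZMod 3) → (Fin N → Bool) → Finset (Fin N) → Prop)
    (Z : ℕ) (ω : (Fin N → Bool) → Finset (Fin N) → ℝ) (β : Fin N → Fin N → ZMod 3) (c : Fin N → ZMod 3) (x : Fin N → Bool)
    (C₀ : Finset (Fin N)) : ℝ :=
  if IsOdd x ∧ C₀ ⊆ klineZeros x ∧ C₀.card = Z ∧ W β c x C₀ then ω (kline x) C₀ else 0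

open scoped Classical in
/-- Auxiliary step `mass_eq_univ` of Sketch29 (planner qa-qnc0-p1 g29, v3, verbatim). -/
theorem mass_eq_univ (W : ∀ {N : ℕ}, (Fin N → Fin N → ZMod 3) → (Fin N → ZMod 3) → (Fin N → Bool) → Finset (Fin N) → Prop)
    (Z : ℕ) (ω : (Fin N → Bool) → Finset (Fin N) → ℝ) (β : Fin N → Fin N → ZMod 3) (c : Fin N → ZMod 3) :
    mass @W Z ω β c = ∑ x : Fin N → Bool, ∑ C₀ : Finset (Fin N), term @W Z ω β c x C₀ := by
  classical
  unfold mass term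
  rw [sum_filter]
  refine sum_congr rfl fun x _ => ?_
  by_cases hx : IsOdd x
  · rw [if_pos hx]
    have hPZ : (klineZeros x).powersetCard Z = univ.filter fun C₀ : Finset (Fin N) => C₀ ⊆ klineZeros x ∧ C₀.card = Z := by
      ext C₀
      simp [mem_powersetCard]
    rw [hPZ, sum_filter]
    refine sum_congr rfl fun C₀ _ => ?_
    by_cases h1 : C₀ ⊆ klineZeros x <;> by_cases h2 : C₀.card = Z <;> by_cases h3 : W β c x C₀ <;> simp [hx, h1, h2, h3]
  · rw [if_neg hx]
    symm
    refine sum_eq_zero fun C₀ _ => ?_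
    rw [if_neg]
    exact fun h => hx h.1

open scoped Classical in
/-- Auxiliary step `term_nonneg` of Sketch29 (planner qa-qnc0-p1 g29, v3, verbatim). -/
theorem term_nonneg {W : ∀ {N : ℕ}, (Fin N → Fin N → ZMod 3) → (Fin N → ZMod 3) → (Fin N → Bool) → Finset (Fin N) → Prop}
    {Z : ℕ} {ω : (Fin N → Bool) → Finset (Fin N) → ℝ} (hω : WindowLaw Z ω) (β : Fin N → Fin N → ZMod 3) (c : Fin N → ZMod 3)
    (x : Fin N → Bool) (C₀ : Finset (Fin N)) : 0 ≤ term @W Z ω β c x C₀ := by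
  unfold term
  split_ifs
  · exact hω.1 _ _
  · exact le_rfl

open scoped Classical in
/-- Auxiliary step `mass_nonneg` of Sketch29 (planner qa-qnc0-p1 g29, v3, verbatim). -/
theorem mass_nonneg {W : ∀ {N : ℕ}, (Fin N → Fin N → ZMod 3) → (Fin N → ZMod 3) → (Fin N → Bool) → Finset (Fin N) → Prop}
    {Z : ℕ} {ω : (Fin N → Bool) → Finset (Fin N) → ℝ} (hω : WindowLaw Z ω) (β : Fin N → Fin N → ZMod 3) (c : Fin N → ZMod 3) :
    0 ≤ mass @W Z ω β c := by
  rw [mass_eq_univ]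
  exact sum_nonneg fun x _ => sum_nonneg fun C₀ _ => term_nonneg hω β c x C₀

open scoped Classical in
/-- **THE RE-INDEXING BOUND (PROVED):** `mass ClassIsoFM ≤ (1 + N·(Z+1)) · mass CubeWitness` under a stable law. -/
theorem mass_classIsoFM_le (hN : 4 ≤ N) {Z : ℕ} {ω : (Fin N → Bool) → Finset (Fin N) → ℝ} (hω : StableLaw Z ω)
    (β : Fin N → Fin N → ZMod 3) (c : Fin N → ZMod 3) :
    mass @ClassIsoFM Z ω β c ≤ (1 + (N : ℝ) * (Z + 1)) * mass @CubeWitness Z ω β c := by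
  classical
  rw [mass_eq_univ, mass_eq_univ]
  set T := term @CubeWitness Z ω β c with hT
  have hT0 : ∀ y C₀, 0 ≤ T y C₀ := fun y C₀ => term_nonneg hω.1 β c y C₀
  have hZ1 : (0 : ℝ) ≤ Z + 1 := by positivity
  -- pointwise bound at each index
  have hpt : ∀ (x : Fin N → Bool) (C₀ : Finset (Fin N)),
      term @ClassIsoFM Z ω β c x C₀ ≤ T x C₀ + (Z + 1 : ℝ) * ∑ u : Fin N, T (flipAt x {prv u, nxt u}) C₀ := by
    intro x C₀
    have hS0 : 0 ≤ ∑ u : Fin N, T (flipAt x {prv u, nxt u}) C₀ := sum_nonneg fun u _ => hT0 _ _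
    by_cases hc : IsOdd x ∧ C₀ ⊆ klineZeros x ∧ C₀.card = Z ∧ ClassIsoFM β c x C₀
    · have hval : term @ClassIsoFM Z ω β c x C₀ = ω (kline x) C₀ := by
        unfold term
        rw [if_pos hc]
      rw [hval]
      obtain ⟨hx, hC₀, hcard, hfm⟩ := hc
      rcases cube_or_toggle hN β c hx hC₀ hfm with hcube | ⟨u, hua, hp, hn, hodd', hC₀', hcube'⟩
      · have h1 : T x C₀ = ω (kline x) C₀ := by
          rw [hT]
          unfold term
          rw [if_pos ⟨hx, hC₀, hcard, hcube⟩]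
        nlinarith
      · have hk : kline (flipAt x {prv u, nxt u}) = Function.update (kline x) u false := by
          rw [(kline_create hN x hx u hp hua hn).2, flipAt_single_eq_update hua]
        have huC : u ∉ C₀ := not_mem_of_active hC₀ hua
        have h1 : ω (kline x) C₀ ≤ (Z + 1 : ℝ) * ω (kline (flipAt x {prv u, nxt u})) C₀ := by
          rw [hk]
          exact hω.2 _ _ _ huC
        have h2 : T (flipAt x {prv u, nxt u}) C₀ = ω (kline (flipAt x {prv u, nxt u})) C₀ := by
          rw [hT]
          unfold term
          rw [if_pos ⟨hodd', hC₀', hcard, hcube'⟩]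
        have h3 : T (flipAt x {prv u, nxt u}) C₀ ≤ ∑ u' : Fin N, T (flipAt x {prv u', nxt u'}) C₀ :=
          single_le_sum (f := fun u' => T (flipAt x {prv u', nxt u'}) C₀) (fun u' _ => hT0 _ _) (mem_univ u)
        nlinarith [hT0 x C₀, mul_le_mul_of_nonneg_left h3 hZ1]
    · have hval : term @ClassIsoFM Z ω β c x C₀ = 0 := by
        unfold term
        rw [if_neg hc]
      rw [hval]
      nlinarith [hT0 x C₀]
  -- re-indexing along the involution x ↦ x ⊕ {prv u, nxt u}
  set S := ∑ x : Fin N → Bool, ∑ C₀ : Finset (Fin N), T x C₀ with hS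
  have hre : ∀ (u : Fin N) (C₀ : Finset (Fin N)),
      ∑ x : Fin N → Bool, T (flipAt x {prv u, nxt u}) C₀ = ∑ x : Fin N → Bool, T x C₀ := by
    intro u C₀
    exact Equiv.sum_comp (Function.Involutive.toPerm _ (flipAt_involutive {prv u, nxt u})) (fun y => T y C₀)
  have hreS : ∀ u : Fin N, ∑ x : Fin N → Bool, ∑ C₀ : Finset (Fin N), T (flipAt x {prv u, nxt u}) C₀ = S := by
    intro u
    rw [hS, sum_comm]
    conv_rhs => rw [sum_comm]
    exact sum_congr rfl fun C₀ _ => hre u C₀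
  have hsum3 : ∑ x : Fin N → Bool, ∑ C₀ : Finset (Fin N), ∑ u : Fin N, T (flipAt x {prv u, nxt u}) C₀ = (N : ℝ) * S := by
    calc ∑ x : Fin N → Bool, ∑ C₀ : Finset (Fin N), ∑ u : Fin N, T (flipAt x {prv u, nxt u}) C₀
        = ∑ x : Fin N → Bool, ∑ u : Fin N, ∑ C₀ : Finset (Fin N), T (flipAt x {prv u, nxt u}) C₀ :=
          sum_congr rfl fun x _ => sum_comm
      _ = ∑ u : Fin N, ∑ x : Fin N → Bool, ∑ C₀ : Finset (Fin N), T (flipAt x {prv u, nxt u}) C₀ := sum_comm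
      _ = ∑ _u : Fin N, S := sum_congr rfl fun u _ => hreS u
      _ = (N : ℝ) * S := by rw [sum_const, card_univ, Fintype.card_fin, nsmul_eq_mul]
  calc ∑ x : Fin N → Bool, ∑ C₀ : Finset (Fin N), term @ClassIsoFM Z ω β c x C₀
      ≤ ∑ x : Fin N → Bool, ∑ C₀ : Finset (Fin N), (T x C₀ + (Z + 1 : ℝ) * ∑ u : Fin N, T (flipAt x {prv u, nxt u}) C₀) :=
        sum_le_sum fun x _ => sum_le_sum fun C₀ _ => hpt x C₀
    _ = S + (Z + 1 : ℝ) * ∑ x : Fin N → Bool, ∑ C₀ : Finset (Fin N), ∑ u : Fin N, T (flipAt x {prv u, nxt u}) C₀ := by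
        rw [hS, mul_sum, ← sum_add_distrib]
        refine sum_congr rfl fun x _ => ?_
        rw [mul_sum, ← sum_add_distrib]
    _ = S + (Z + 1 : ℝ) * ((N : ℝ) * S) := by rw [hsum3]
    _ = (1 + (N : ℝ) * (Z + 1)) * S := by ring

/-- **`HClassB` PROVED** (with `b = K + 2` and the same window size). -/
theorem hClassB : HClassB := by
  intro a K
  refine ⟨K + 2, 4, fun N hN Z hZ ω hω β c hm => ⟨Z, le_trans hZ (Nat.mul_le_mul_right _ (by omega)), ω, hω.1, ?_⟩⟩
  have hN1 : (1 : ℝ) ≤ N := by exact_mod_cast (show 1 ≤ N by omega)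
  have hN2 : (2 : ℝ) ≤ N := by exact_mod_cast (show 2 ≤ N by omega)
  have key := mass_classIsoFM_le hN hω β c
  have hMC := mass_nonneg (W := @CubeWitness) hω.1 β c
  have hlog : ((2 : ℕ) ^ Nat.log 2 N : ℝ) ≤ (N : ℝ) := by exact_mod_cast Nat.pow_log_le_self 2 (by omega : N ≠ 0)
  have h2Z : (2 : ℝ) ^ Z ≤ (N : ℝ) ^ K := by
    calc (2 : ℝ) ^ Z ≤ (2 : ℝ) ^ (K * Nat.log 2 N) := pow_le_pow_right₀ (by norm_num) hZ
      _ = ((2 : ℝ) ^ Nat.log 2 N) ^ K := by rw [mul_comm, pow_mul]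
      _ ≤ (N : ℝ) ^ K := pow_le_pow_left₀ (by positivity) (by exact_mod_cast hlog) K
  have hZ2 : (Z + 1 : ℝ) ≤ (2 : ℝ) ^ Z := by exact_mod_cast Nat.lt_two_pow_self
  have hNK : (0 : ℝ) < (N : ℝ) ^ K := by positivity
  have hD : 1 + (N : ℝ) * (Z + 1) ≤ (N : ℝ) ^ (K + 2) := by
    have h1 : (N : ℝ) * (Z + 1) ≤ (N : ℝ) * (N : ℝ) ^ K := mul_le_mul_of_nonneg_left (hZ2.trans h2Z) (by positivity)
    have h2 : (1 : ℝ) ≤ (N : ℝ) * (N : ℝ) ^ K := by nlinarith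
    have h3 : (N : ℝ) ^ (K + 2) = (N : ℝ) * (N : ℝ) * (N : ℝ) ^ K := by ring
    nlinarith
  have hNK2 : (0 : ℝ) < (N : ℝ) ^ (K + 2) := by positivity
  have hup : 1 / (N : ℝ) ^ a * (2 : ℝ) ^ (N - 1) ≤ (N : ℝ) ^ (K + 2) * mass @CubeWitness Z ω β c :=
    (hm.trans key).trans (mul_le_mul_of_nonneg_right hD hMC)
  calc 1 / (N : ℝ) ^ (a + (K + 2)) * (2 : ℝ) ^ (N - 1)
      = (1 / (N : ℝ) ^ a * (2 : ℝ) ^ (N - 1)) / (N : ℝ) ^ (K + 2) := by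
        rw [pow_add]
        field_simp
    _ ≤ ((N : ℝ) ^ (K + 2) * mass @CubeWitness Z ω β c) / (N : ℝ) ^ (K + 2) := div_le_div_of_nonneg_right hup hNK2.le
    _ = mass @CubeWitness Z ω β c := by field_simp

/-- **(NP₁) FROM THE SINGLE c-FREE CONJECTURE `HClassA` (PROVED).** -/
theorem polyLoss_of_classA (hA : HClassA) : AffBellsPolyLoss3 := polyLoss_of_classAB hA hClassB

/-- The same, one level up: `HClassA` gives `HCube`. -/
theorem hCube_of_classA (hA : HClassA) : HCube := hCube_of_classAB hA hClassB

end AffBells29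

end Summit.QuantumAdvantage.AdviceFreeQNC0
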